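import Mathlib
import HarnessLib
import Summits.HubbardSuperconductivity.HubbardSuperconductivity.Theses.ChiralWindow
import Summits.HubbardSuperconductivity.HubbardSuperconductivity.Theorems.ChiralWindowCwChiralConstructionCornerReduction

/-!
# Crux `CwChiralConstruction` (stmt-HubbardSuperconductivity-1740): the lead's skeleton, RESIDUAL form

Route `HubbardSuperconductivity/ChiralWindow`, rank-2 crux ("the programme"). Lead seat
prover-line-stmt-HubbardSuperconductivity-1740-c1-0 (continuation seat, gen 1), 2026-08-16.

History. Line `susceptibility-rise-budget` (idea card `Cruxes/CwChiralConstruction/Ideas/…`, planner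
skeleton `Lines/susceptibility-rise-budget.lean`, lead-0 skeleton `Lines/susceptibility_rise_budget.lean`,
registered sha 702b9d4a) had ALL its soft content landed by lead 0 (p79041 p81552 p84428 p85426 p85392
p86909 p89015 p90642 + sibling p76736) and ended `promote-stub` on its single open stub
`stub_chiralCornerWindow`; the concurrent re-seat lead 1 declared the LINE dead at that stub
(`Lines/susceptibility-rise-budget-dead.md`, 2026-08-16T10:25Z): the stub is a strengthening of the
crux's order clause (corner value + L-uniform gap/variance profiles along two source legs), not a
reduction of it.

This skeleton keeps the line's one genuine reduction — the DENSITY clause is discharged at a generic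
chemical potential by landed theorems (`cw_genericDensity`) — and states the irreducible remainder in
its natural, weakest useful form, with no corner, no co-source and no transport data:

* `stub_klDWaveOrderOnFillingWindow` (THE ONLY STUB; conjectural — it is the Kohn–Luttinger
  `d_{x²-y²}`-order statement itself, grand-canonical, Koma–Tasaki order parameter): there are free
  fillings `13/25 < n₁ < n₂ < 7/10`, `U₀ > 0`, `C > 0` with `exp(-C/U²) ≤ dWaveOrderParameter U μ` for
  all `U ∈ (0, U₀)` and all `μ` whose free filling lies in `[n₁, n₂]`.
* `CwChiralConstruction_of` (proved, ~50 lines): intermediate value theorem for the continuous free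
  filling (`stub_freeBandLimit`, landed p86909) to place a `μ`-interval with fillings inside the window,
  `cw_genericDensity` (landed p90642) for a `μ` in it with a convergent interacting density `1 - δ`,
  `δ ∈ [3/10, 12/25]`, and the stub's floor at that `μ`.

The same two steps are landed stand-alone as `cwChiralConstruction_of_orderOnOpenSet` /
`cwChiralConstruction_of_orderOnFillingWindow` (Theorems/ChiralWindowCwChiralConstructionResidual.lean,
proposal pending at the time of writing). Converse bookkeeping (disprover, landed p85938
`cwChiralConstruction_pinned`): the crux implies the same floor at SOME `μ ∈ [-37/10, -1/20]` per small
`U`. Hence crux ≈ stub up to the density clause at non-generic `μ`: the stub is crux-sized by nature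
(open constructive problem: weak-coupling BCS/Kohn–Luttinger order for 2D lattice fermions; Disproof.lean
§E; grounder 2026-08-15), which is exactly what this skeleton is meant to make machine-visible.
-/

set_option linter.dupNamespace false

namespace Summit.HubbardSuperconductivity.HubbardSuperconductivity.Theorems

open Literature.MathematicalPhysics.QuantumLattice Filter
open Summit.HubbardSuperconductivity.HubbardSuperconductivity.Theses.ChiralWindow
open scoped Topology

/-! ### Registered stub -/

/-- **Stub `stub_klDWaveOrderOnFillingWindow`** (THE CORE; conjectural step — Kohn–Luttinger
`d_{x²-y²}` order at weak repulsion on a hole-doped filling window, in the tree's grand-canonical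
Koma–Tasaki vocabulary): there are fillings `13/25 < n₁ < n₂ < 7/10`, a threshold `U₀ > 0` and `C > 0`
such that for all `U ∈ (0, U₀)` and all chemical potentials `μ` with free filling
`KohnLuttinger.filling (squareDispersion 1 0) μ ∈ [n₁, n₂]`, `exp(-C/U²) ≤ dWaveOrderParameter U μ`.
Folklore support: second-order KL census (Disproof.lean §H, job j010500): B₁g is the leading channel for
`n ∈ [0.60, 0.80]`, so e.g. `[n₁, n₂] = [0.65, 0.69]` sits inside the B₁g-dominated region with margin;
expected `m_d ≍ exp(-1/(a(n)U²))`, `a ≥ a_min > 0` there, floor with `C > 1/a_min`. No rigorous method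
reaches it (WeakCouplingCeiling, PerturbativeInvisibilityOfPairing; BGM2006 Thm 1.1 stops at
`β⁻¹ ≥ e^{-a/U}`; FKT2004 needs an asymmetric Fermi curve; Mastropietro2008 Ch. 15 needs a long-range
BCS term). [conjectural step] -/
theorem stub_klDWaveOrderOnFillingWindow :
    ∃ n₁ n₂ U₀ C : ℝ, 13 / 25 < n₁ ∧ n₁ < n₂ ∧ n₂ < 7 / 10 ∧ 0 < U₀ ∧ 0 < C ∧
      ∀ U ∈ Set.Ioo (0 : ℝ) U₀, ∀ μ : ℝ,
        KohnLuttinger.filling (squareDispersion 1 0) μ ∈ Set.Icc n₁ n₂ →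
          Real.exp (-C / U ^ 2) ≤ dWaveOrderParameter U μ := by
  sorry

/-! ### Frame: free-filling window (IVT) + generic density ⟹ the crux -/

/-- **Composition.** `stub_klDWaveOrderOnFillingWindow` implies the crux `CwChiralConstruction` BY NAME:
the free filling is continuous, `0` at `μ = -4` and `2` at `μ = 5` (`stub_freeBandLimit`), so a
`μ`-interval with free fillings in `(n₁, n₂) ⊆ [13/25 + η, 7/10 - η]` exists
(`η = min (n₁ - 13/25) (7/10 - n₂)`); `cw_genericDensity` picks `μ` in it with interacting density
`→ 1 - δ`, `δ ∈ [3/10, 12/25]`, for all `U` below its threshold; the stub gives the floor there.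
[folklore: intermediate value theorem; Griffiths 1964] -/
theorem CwChiralConstruction_of : CwChiralConstruction := by
  obtain ⟨n₁, n₂, U₀, C, hn₁, hn₁₂, hn₂, hU₀, hC, H⟩ := stub_klDWaveOrderOnFillingWindow
  obtain ⟨_, _, _, hFc, hF0, hF2⟩ := stub_freeBandLimit
  set F : ℝ → ℝ := fun μ => KohnLuttinger.filling (squareDispersion 1 0) μ with hFdef
  -- intermediate value theorem on `[-4, 5]`: a `μ⋆` with filling `(n₁ + n₂)/2`
  have hFm4 : F (-4) = 0 := hF0 (-4) le_rfl
  have hF5 : F 5 = 2 := hF2 5 (by norm_num)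
  have hmid : (n₁ + n₂) / 2 ∈ Set.Icc (F (-4)) (F 5) := by
    rw [hFm4, hF5]
    constructor <;> linarith
  obtain ⟨μs, _, hμs⟩ :=
    intermediate_value_Icc (by norm_num : (-4 : ℝ) ≤ 5) hFc.continuousOn hmid
  -- continuity at `μ⋆`: fillings stay in `(n₁, n₂)` on a neighbourhood
  have hw : 0 < (n₂ - n₁) / 2 := by linarith
  obtain ⟨r, hr, hball⟩ := Metric.continuousAt_iff.1 (hFc.continuousAt (x := μs)) _ hw
  have hnear : ∀ μ ∈ Set.Icc (μs - r / 2) (μs + r / 2), n₁ < F μ ∧ F μ < n₂ := by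
    intro μ hμ
    have hd : dist μ μs < r := by
      rw [Real.dist_eq, abs_lt]
      constructor <;> linarith [hμ.1, hμ.2]
    have := hball hd
    rw [Real.dist_eq, abs_lt, hμs] at this
    constructor <;> linarith [this.1, this.2]
  -- the window margin and the generic-density threshold
  set η : ℝ := min (n₁ - 13 / 25) (7 / 10 - n₂) with hηdef
  have hη : 0 < η := lt_min (by linarith) (by linarith)
  have hη₁ : η ≤ n₁ - 13 / 25 := min_le_left _ _
  have hη₂ : η ≤ 7 / 10 - n₂ := min_le_right _ _
  obtain ⟨U₁, hU₁, dens⟩ := cw_genericDensity η hη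
  refine ⟨min U₀ U₁, lt_min hU₀ hU₁, C, hC, fun U hU => ?_⟩
  have hUU₀ : U ∈ Set.Ioo (0 : ℝ) U₀ := ⟨hU.1, hU.2.trans_le (min_le_left _ _)⟩
  have hUU₁ : U ∈ Set.Ioo (0 : ℝ) U₁ := ⟨hU.1, hU.2.trans_le (min_le_right _ _)⟩
  have hfill : ∀ μ ∈ Set.Icc (μs - r / 2) (μs + r / 2),
      KohnLuttinger.filling (squareDispersion 1 0) μ ∈ Set.Icc (13 / 25 + η) (7 / 10 - η) := by
    intro μ hμ
    obtain ⟨h1, h2⟩ := hnear μ hμ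
    exact ⟨by linarith, by linarith⟩
  obtain ⟨μ, hμ, δ, hδ, hdens⟩ := dens U hUU₁ (μs - r / 2) (μs + r / 2) (by linarith) hfill
  refine ⟨δ, hδ, μ, hdens, ?_⟩
  obtain ⟨h1, h2⟩ := hnear μ (Set.Ioo_subset_Icc_self hμ)
  exact H U hUU₀ μ ⟨h1.le, h2.le⟩

end Summit.HubbardSuperconductivity.HubbardSuperconductivity.Theorems
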